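import Summits.Ventures.HSemireg.UntwistCocycleTwistWedgeTrace
import Summits.Ventures.HSemireg.UntwistCocycleTwistIota
import Summits.Ventures.HSemireg.UntwistLeibnizTriangular
import Literature.AlgebraicGeometry.HodgeTheory.AtiyahClassStepCech
import Literature.AlgebraicGeometry.Modules.ExtCohomologyComparison
import Summits.Ventures.HSemireg.UntwistFullSigma
import HarnessLib

/-!
# Venture HSemireg — route R1.0, untwisted reading: **ALL rows `q` of the Leibniz re-expansion `hσ` on real carriers,
# on a framed point cover, modulo the centrality of `[dlog g] ∧ –`** (gs-g4; assembly (L7) of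
# `general-structure/LEIBNIZ-ROW2-PLAN-gs-g4.md` §5, instantiating `UntwistLeibnizTriangular.lean`)

HONEST FRAMING. Module-level homological algebra on the tree's REAL carriers (`sigmaHigher` of
`HodgeTheory/SemiregularityHigherSigma.lean`, th-4's cocycle twist `E⟨c⟩`, Čech classes). Nothing about any variety; no
gerbe; nothing here says HC, HC_CM or HC_AV is proved.

SETTING. A cocycle `c`, a finite locally free `E`, and a point-indexed cover `W_x ⊆ U_x` of `X` carrying frames `e_x`
of `E|_{W_x}` and coframes `w^j_x` of `Ωʲ|_{W_x}` for `j ≤ N` (such a cover exists when the `Ωʲ` are finite locally free: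
sequel file). On it:
* the LEIBNIZ rule for every Atiyah step `at_j`, `j + 1 ≤ N` — `UntwistCocycleTwistAtiyahHigher.atiyahClassStep_twist`
  with the bi-frame sections `frameTwistJetSection` (th-4, `HodgeTheory/AtiyahClassStepCech.lean`);
* the COMPARISON `Tr′(θ y · [λ]) = Tr(y)` — `UntwistCocycleTwistDualHomTrace`;
* the LINEARITY `Tr′(y · [ν′_j]) = Tr′(y) · ([dlog g] ∧ –)` — `UntwistCocycleTwistWedgeTrace`;
* `ι′ = ι⟨c⟩ ≫ λ_0` — `UntwistCocycleTwistIota`;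
* the CENTRALITY `ν′_m · at′_{m+1} = at′_m · ν′_{m+1}` (`m + 1 < N`) enters as the HYPOTHESIS `hcen` (th-4's
  `UntwistAtiyahStepCommuteLocFree.atiyahClassStep_comp_wedgeClass_of_coframes` discharges it; sequel file).

WHAT IS PROVED (no `def`).
* **`traceExtCoeff_sigma_twist_exists_of_cover`** — for `q ≤ N` there are additive
  `V_i : Ext^{i+2}(𝒪_X, Ωⁱ) → Ext^{q+2}(𝒪_X, Ω^q)` with, for every `x ∈ Ext²(E, E)`,
  `Tr′_{Ω^q}((θx · ι′) · At(E⟨c⟩)^q) = Tr_{Ω^q}((x · ι) · At(E)^q) + Σ_{i<q} V_i(Tr_{Ωⁱ}((x · ι) · At(E)^i))`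
  (`UntwistLeibnizTriangular.exists_triangular_pow` on the tree's carriers);
* **`isISemiregular_iff_twist_of_cover`** — **`IsISemiregular(E, I) ↔ IsISemiregular(E⟨c⟩, I)` for every LOWER
  set `I` of form degrees `≤ N`**, on the framed cover, modulo `hcen`: th-4's kernel clause
  `UntwistFullSigma.jointlyInjective_iff_of_triangular` on the `Ext`-level components (the comparison
  `Extⁿ(𝒪_X, G) → Hⁿ(X, G)` is injective, Hartshorne III.6.3, `extToCohomology_bijective`), `θ = - ⊗ M` bijective
  (`mapExtAddHom_twist_bijective`), `d_q = id` — i.e. th-4's `isISemiregular_iff_twist` with its binder `hσ`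
  DISCHARGED for all rows `q ≤ N`; and the cover-free form `isISemiregular_iff_twist_of_exists` (any lower `I`,
  given the `Ext`-level rows for `q ∈ I`), used by the sequel file with one cover per degree.

## References

* R.-O. Buchweitz, H. Flenner, *A semiregularity map for modules and applications to deformations*, Compositio
  Math. 137 (2003), §4, Def. 4.1, §5. [BuchweitzFlenner2003]
* M. F. Atiyah, *Complex analytic connections in fibre bundles*, Trans. AMS 85 (1957), Prop. 10, Prop. 12. [Atiyah1957]
* R. Hartshorne, *Algebraic Geometry* (1977), III Prop. 6.3. [Hartshorne1977]
-/

noncomputable section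

open CategoryTheory CategoryTheory.Abelian AlgebraicGeometry Opposite TopologicalSpace Limits Finset

namespace Summit.Ventures.HSemireg

namespace CocycleTwist

open Literature.AlgebraicGeometry.Modules Literature.AlgebraicGeometry.Motives
  Literature.AlgebraicGeometry.HodgeTheory Literature.AlgebraicGeometry.Modules.Cech Literature.Algebra.Homology
  LeibnizChain

universe u

variable {S : Type u} [CommRing S] {X : Over (Spec (CommRingCat.of S))} [HasExt.{u + 1} X.left.Modules]
  (c : UnitCocycle X.left) {E : X.left.Modules} (hE : IsFiniteLocallyFree E)
  (W : X.left → X.left.Opens) (hWU : ∀ x, W x ≤ c.U x) (hW : iSup W = ⊤) (N : ℕ)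
  {I : X.left → Type u} [∀ x, Fintype (I x)] (e : ∀ x, SheafOfModules.free (I x) ≅ E.over (W x))
  {K : ℕ → X.left → Type u} [∀ j x, Fintype (K j x)]
  (w : ∀ (j : ℕ) (x : X.left), j ≤ N → (SheafOfModules.free (K j x) ≅ (hodgeSheaf X j).over (W x)))
  (hcen : ∀ m, m + 1 < N →
    (classOf (exactAugmentation W _ hW) (twistWedgeFamily c E m W hWU) (dFamily_twistWedgeFamily c E m W hWU)).comp
        (atiyahClassStep (twist c E) (m + 1)) (rfl : 1 + 1 = 2) =
      (atiyahClassStep (twist c E) m).comp (classOf (exactAugmentation W _ hW) (twistWedgeFamily c E (m + 1) W hWU)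
        (dFamily_twistWedgeFamily c E (m + 1) W hWU)) rfl)

include e w hcen in
/-- **All rows `q ≤ N` of `hσ` before sheaf cohomology, on a framed cover, modulo centrality**: there are additive
`V_i : Ext^{i+2}(𝒪_X, Ωⁱ) → Ext^{q+2}(𝒪_X, Ω^q)` with
`Tr′_{Ω^q}((θx · ι′) · At(E⟨c⟩)^q) = Tr_{Ω^q}((x · ι) · At(E)^q) + Σ_{i<q} V_i(Tr_{Ωⁱ}((x · ι) · At(E)^i))` for every
`x ∈ Ext²(E, E)` (`UntwistLeibnizTriangular.exists_triangular_pow` with the Leibniz rule `atiyahClassStep_twist` on the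
bi-frame sections, the comparison `traceExtCoeff_twist_comp_dualHomTwist`, the linearity
`traceExtCoeff_twist_comp_twistWedgeClass`, and `toTwistHodgeZero_twist`). [cite: BuchweitzFlenner2003, Def. 4.1; Atiyah1957, Prop. 10 and Prop. 12] -/
theorem traceExtCoeff_sigma_twist_exists_of_cover (q : ℕ) (hq : q ≤ N) :
    ∃ V : ∀ i, Ext.{u + 1} (unitModule X.left) (hodgeSheaf X i) (i + 2) →+
        Ext.{u + 1} (unitModule X.left) (hodgeSheaf X q) (q + 2),
      ∀ x : Ext.{u + 1} E E 2,
        traceExtCoeff (isFiniteLocallyFree_twist c hE) (hodgeSheaf X q) (q + 2)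
            ((((twistEquivalence X.left c).functor.mapExtAddHom E E 2 x).comp
              (Ext.mk₀ (toTwistHodgeZero (twist c E))) (add_zero 2)).comp (atiyahClassPower (twist c E) q)
              (add_comm 2 q)) =
          traceExtCoeff hE (hodgeSheaf X q) (q + 2)
              ((x.comp (Ext.mk₀ (toTwistHodgeZero E)) (add_zero 2)).comp (atiyahClassPower E q) (add_comm 2 q)) +
            ∑ i ∈ range q, V i (traceExtCoeff hE (hodgeSheaf X i) (i + 2)
              ((x.comp (Ext.mk₀ (toTwistHodgeZero E)) (add_zero 2)).comp (atiyahClassPower E i) (add_comm 2 i))) := by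
  refine exists_triangular_pow (twistEquivalence X.left c).functor (E := E) (F := twistHodge E)
    (G := twistHodge (twist c E)) (fun j => dualHomTwistObj c E (hodgeSheaf X j)) (fun j => atiyahClassStep E j)
    (fun j => atiyahClassStep (twist c E) j)
    (fun j => classOf (exactAugmentation W _ hW) (twistWedgeFamily c E j W hWU) (dFamily_twistWedgeFamily c E j W hWU))
    (fun i => traceExtCoeff hE (hodgeSheaf X i) (i + 2))
    (fun i => traceExtCoeff (isFiniteLocallyFree_twist c hE) (hodgeSheaf X i) (i + 2))
    (fun i => (classOf (exactAugmentation W (hodgeSheaf X (i + 1)) hW)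
      (fun β => wedgeHomAt i (dlogForm c (β 0) (β 1) (face W β) ((face_le _ β 0).trans (hWU (β 0)))
        ((face_le _ β 1).trans (hWU (β 1)))) : LocalFamily W 1 (hodgeSheaf X i) (hodgeSheaf X (i + 1)))
      (dFamily_wedgeHomAt_dlogForm c i W hWU)).postcomp (unitModule X.left) (by omega))
    N (fun j hj => ?_) hcen (fun i _ y => traceExtCoeff_twist_comp_dualHomTwist c E (hodgeSheaf X i) hE (i + 2) y)
    (fun i _ y => traceExtCoeff_twist_comp_twistWedgeClass c i W hWU hW hE y)
    (toTwistHodgeZero E) (toTwistHodgeZero (twist c E)) (toTwistHodgeZero_twist c E).symm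
    (atiyahClassPower E) rfl (fun _ => rfl) (atiyahClassPower (twist c E)) rfl (fun _ => rfl) q hq
  -- the Leibniz rule at level `j`, from the bi-frame sections on `W_x`
  have h := atiyahClassStep_twist c E j W hWU hW (fun x => frameTwistJetSection E j (e x) (w j x (by omega)))
    (fun x => frameTwistJetSection_comp_π E j (e x) (w j x (by omega)))
  rw [atiyahClassStepTwistMain_def] at h
  exact h

/-- **`I`-semiregularity of `E` iff of `E ⊗ M`, from the `Ext`-level triangular rows** (cover-free form): if for
every `q ∈ I`, `I` a LOWER set, there are additive `V_i` with
`Tr′_{Ω^q}((θx · ι′) · At(E⟨c⟩)^q) = Tr_{Ω^q}((x · ι) · At(E)^q) + Σ_{i<q} V_i(Tr_{Ωⁱ}((x · ι) · At(E)^i))` for all `x`, then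
`IsISemiregular(E, I) ↔ IsISemiregular(E⟨c⟩, I)` — th-4's kernel clause `UntwistFullSigma.jointlyInjective_iff_of_triangular`
on the `Ext`-level components (the comparison `Extⁿ(𝒪_X, G) → Hⁿ(X, G)` is injective, Hartshorne III.6.3, so
`σ_q x = 0 ↔ Tr_{Ω^q}((x · ι) · At^q) = 0`), with `θ = - ⊗ M` bijective (`mapExtAddHom_twist_bijective`) and `d_q = id`.
[cite: BuchweitzFlenner2003, §5 (I-semiregular); Hartshorne1977, III Prop. 6.3 (c)] -/
theorem isISemiregular_iff_twist_of_exists {I : Set ℕ} (hI : IsLowerSet I)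
    (hex : ∀ q ∈ I, ∃ V : ∀ i, Ext.{u + 1} (unitModule X.left) (hodgeSheaf X i) (i + 2) →+
        Ext.{u + 1} (unitModule X.left) (hodgeSheaf X q) (q + 2),
      ∀ x : Ext.{u + 1} E E 2,
        traceExtCoeff (isFiniteLocallyFree_twist c hE) (hodgeSheaf X q) (q + 2)
            ((((twistEquivalence X.left c).functor.mapExtAddHom E E 2 x).comp
              (Ext.mk₀ (toTwistHodgeZero (twist c E))) (add_zero 2)).comp (atiyahClassPower (twist c E) q)
              (add_comm 2 q)) =
          traceExtCoeff hE (hodgeSheaf X q) (q + 2)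
              ((x.comp (Ext.mk₀ (toTwistHodgeZero E)) (add_zero 2)).comp (atiyahClassPower E q) (add_comm 2 q)) +
            ∑ i ∈ range q, V i (traceExtCoeff hE (hodgeSheaf X i) (i + 2)
              ((x.comp (Ext.mk₀ (toTwistHodgeZero E)) (add_zero 2)).comp (atiyahClassPower E i) (add_comm 2 i)))) :
    IsISemiregular.{u + 1} hE I ↔ IsISemiregular.{u + 1} (isFiniteLocallyFree_twist c hE) I := by
  classical
  choose V hV using hex
  -- the `Ext`-level components `x ↦ Tr_{Ω^q}((x · ι) · At^q)` of `E` and of `E⟨c⟩`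
  have key := jointlyInjective_iff_of_triangular
    (σ := fun q => (traceExtCoeff hE (hodgeSheaf X q) (q + 2)).comp
      (((atiyahClassPower E q).postcomp E (add_comm 2 q)).comp
        ((Ext.mk₀ (toTwistHodgeZero E)).postcomp E (add_zero 2))))
    (σ' := fun q => (traceExtCoeff (isFiniteLocallyFree_twist c hE) (hodgeSheaf X q) (q + 2)).comp
      (((atiyahClassPower (twist c E) q).postcomp (twist c E) (add_comm 2 q)).comp
        ((Ext.mk₀ (toTwistHodgeZero (twist c E))).postcomp (twist c E) (add_zero 2))))
    (AddEquiv.ofBijective ((twistEquivalence X.left c).functor.mapExtAddHom E E 2)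
      (mapExtAddHom_twist_bijective c E E 2))
    (fun q => AddMonoidHom.id _) (fun q j => if h : q ∈ I then V q h j else 0) hI
    (fun _ _ => Function.injective_id) (fun q hq x => by
      simp only [dif_pos hq]
      exact hV q hq x)
  have e0 : ∀ (q : ℕ) (x : Ext.{u + 1} E E 2), sigmaHigher hE q x = 0 ↔
      (traceExtCoeff hE (hodgeSheaf X q) (q + 2)).comp
        (((atiyahClassPower E q).postcomp E (add_comm 2 q)).comp
          ((Ext.mk₀ (toTwistHodgeZero E)).postcomp E (add_zero 2))) x = 0 := fun q x =>
    map_eq_zero_iff (extToCohomology (hodgeSheaf X q) (q + 2)) (extToCohomology_bijective (hodgeSheaf X q) (q + 2)).1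
  have e1 : ∀ (q : ℕ) (x' : Ext.{u + 1} (twist c E) (twist c E) 2),
      sigmaHigher (isFiniteLocallyFree_twist c hE) q x' = 0 ↔
      (traceExtCoeff (isFiniteLocallyFree_twist c hE) (hodgeSheaf X q) (q + 2)).comp
        (((atiyahClassPower (twist c E) q).postcomp (twist c E) (add_comm 2 q)).comp
          ((Ext.mk₀ (toTwistHodgeZero (twist c E))).postcomp (twist c E) (add_zero 2))) x' = 0 := fun q x' =>
    map_eq_zero_iff (extToCohomology (hodgeSheaf X q) (q + 2)) (extToCohomology_bijective (hodgeSheaf X q) (q + 2)).1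
  exact ((isISemiregular_iff hE I).trans (forall_congr' fun x =>
      imp_congr_left (forall₂_congr fun q _ => e0 q x))).trans
    (key.trans ((isISemiregular_iff (isFiniteLocallyFree_twist c hE) I).trans
      (forall_congr' fun x' => imp_congr_left (forall₂_congr fun q _ => e1 q x'))).symm)

include e w hcen in
/-- **`I`-semiregularity of `E` iff of `E ⊗ M` on a framed cover, modulo centrality**, for every LOWER set `I` of form
degrees `≤ N` (`isISemiregular_iff_twist_of_exists` with the rows `traceExtCoeff_sigma_twist_exists_of_cover`): th-4's
`isISemiregular_iff_twist` with its binder `hσ` DISCHARGED in all degrees `q ≤ N`.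
[cite: BuchweitzFlenner2003, §5 (I-semiregular); Atiyah1957, Prop. 10 and Prop. 12] -/
theorem isISemiregular_iff_twist_of_cover {I : Set ℕ} (hI : IsLowerSet I) (hIN : ∀ q ∈ I, q ≤ N) :
    IsISemiregular.{u + 1} hE I ↔ IsISemiregular.{u + 1} (isFiniteLocallyFree_twist c hE) I :=
  isISemiregular_iff_twist_of_exists c hE hI fun q hq =>
    traceExtCoeff_sigma_twist_exists_of_cover c hE W hWU hW N e w hcen q (hIN q hq)

end CocycleTwist

end Summit.Ventures.HSemireg

end
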